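import Literature.Combinatorics.LorentzianPolynomials.RayleighOperations
import Literature.Probability.NegativeDependence.RayleighMeasures
import Mathlib.Algebra.MvPolynomial.Funext
import HarnessLib

/-!
# Translation and dilution of Rayleigh measures (Borcea–Brändén–Liggett, Prop. 2.1 (2) and (6))

J. Borcea, P. Brändén, T. M. Liggett, *Negative dependence and the geometry of polynomials*, J. Amer. Math.
Soc. 22 (2009) 521–567 (arXiv:0707.2340, held `paper:arxiv-0707.2340`), §2.1. Verbatim:

> **Proposition 2.1.** If `f(z_1,…,z_n)` is Rayleigh then so are the following polynomials:
> (1) `∂^S f` […]; (2) the "translation" `f(z+α)`, where `z+α = (z_1+α_1,…,z_n+α_n)`, `z = (z_1,…,z_n)`,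
> `α = (α_1,…,α_n) ∈ ℝ_+^n`; (3) `f(z_1,…,z_{i-1},0,z_{i+1},…,z_n)` […]; (4) the "dilation" […];
> (5) the "inversion" […]; (6) the polynomial in `nk` variables
> `f(k^{-1}Σ_{i=1}^k z_{1i},…,k^{-1}Σ_{i=1}^k z_{ni})`.

Items (1), (3), (4) are `isRayleigh_derivWeight`, `isRayleigh_pinOut`, `isRayleigh_extField` (`RayleighMeasures.lean`)
and (5) is `isRayleigh_invWeight` (`WeightInversion.lean`); this file adds (2) and (6), so that Prop. 2.1 is in the
tree in full.

## Transposition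

* Weights `μ : Finset σ → ℝ` with `g_μ = multiAffine μ = Σ_S μ(S) z^S`; `IsRayleigh μ` (Def. 2.5, open orthant).
* (2) The translation `g_μ(z + a)` is the generating polynomial of `translW a μ : S ↦ Σ_{T ⊇ S} μ(T) a^{T∖S}`
  (`eval_multiAffine_translW`, `multiAffine_translW` = the tree's `LorentzianPolynomials.translate a (multiAffine μ)`);
  `Δ_{ij}(g(z+a))(x) = Δ_{ij}(g)(x+a)` gives **`isRayleigh_translW`** for `a ≥ 0` (any Rayleigh weight).
* (6) The dilution is formalized for an arbitrary block structure `b : τ → σ` (new variables `τ`, the block of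
  `i ∈ σ` being the fiber `b⁻¹(i)` of size `κ_i`; BBL's case is `τ = σ × [k]`, `b = pr_1`, all `κ_i = k`):
  `g_μ((κ_i^{-1} Σ_{v ∈ b⁻¹(i)} z_v)_i)` is multi-affine in the `z_v` with coefficient weight
  `dilute b μ : U ↦ [b injective on U] · μ(b(U)) · Π_{v∈U} κ_{b(v)}^{-1}` (`eval_multiAffine_dilute`, the expansion of
  `Π_{i∈S} κ_i^{-1} Σ_{v∈b⁻¹(i)} z_v` over the sections of `b` above `S`: `sum_sections_prod`). With
  `∂_v (dilute b μ) = κ_{b(v)}^{-1} · dilute b (∂_{b(v)} μ)` (`derivWeight_dilute`) one gets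
  `Δ_{vw}(dilution)(x) = κ_{b v}^{-1} κ_{b w}^{-1} Δ_{b(v) b(w)}(g_μ)(x̄)` at the block averages `x̄`, whence
  **`isRayleigh_dilute`** (any Rayleigh weight, any `b`; empty blocks allowed, their averages being `0`, where the
  closed-orthant Rayleigh inequality `IsRayleigh.eval_rayleighDiff_nonneg` is used).

## References

* [BorceaBrandenLiggett2007] J. Borcea, P. Brändén, T. M. Liggett, Negative dependence and the geometry of
  polynomials, J. Amer. Math. Soc. 22 (2009), 521–567; arXiv:0707.2340 — §2.1 Prop. 2.1 (2), (6).
* [BrandenHuh2019] P. Brändén, J. Huh, Lorentzian polynomials, Ann. of Math. 192 (2020) — §2.4 Lemma 2.20 (5)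
  (translation, the tree's `translate`).
-/

noncomputable section

open Finset MvPolynomial
open Literature.Combinatorics.Sahi2008
open Literature.Combinatorics.StablePolynomials
open Literature.Combinatorics.LorentzianPolynomials

namespace Literature.Probability.NegativeDependence

variable {σ : Type*} [Fintype σ] [DecidableEq σ]

/-! ## §1 Translation (Prop. 2.1 (2)) -/

section Translation

/-- **The translated weight**: `S ↦ Σ_{T ⊇ S} μ(T) a^{T∖S}`, the coefficient weight of `g_μ(z + a)`.
[cite: BorceaBrandenLiggett2007, §2.1 Prop. 2.1 (2) ("the 'translation' `f(z+α)`")] -/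
def translW (a : σ → ℝ) (μ : Finset σ → ℝ) : Finset σ → ℝ := fun S =>
  ∑ T : Finset σ, if S ⊆ T then μ T * ∏ i ∈ T \ S, a i else 0

/-- Unfolding `translW`. [cite: BorceaBrandenLiggett2007, §2.1 Prop. 2.1 (2)] -/
theorem translW_apply (a : σ → ℝ) (μ : Finset σ → ℝ) (S : Finset σ) :
    translW a μ S = ∑ T : Finset σ, if S ⊆ T then μ T * ∏ i ∈ T \ S, a i else 0 := rfl

/-- Translation by `a ≥ 0` keeps nonnegativity. [cite: BorceaBrandenLiggett2007, §2.1 Prop. 2.1 (2)] -/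
theorem translW_nonneg {μ : Finset σ → ℝ} (h0 : ∀ S, 0 ≤ μ S) {a : σ → ℝ} (ha : ∀ i, 0 ≤ a i) (S : Finset σ) :
    0 ≤ translW a μ S :=
  Finset.sum_nonneg fun T _ => by
    split_ifs
    · exact mul_nonneg (h0 T) (Finset.prod_nonneg fun i _ => ha i)
    · exact le_rfl

/-- **`g_{translW a μ}(x) = g_μ(x + a)`.** [cite: BorceaBrandenLiggett2007, §2.1 Prop. 2.1 (2)] -/
theorem eval_multiAffine_translW (a : σ → ℝ) (μ : Finset σ → ℝ) (x : σ → ℝ) :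
    MvPolynomial.eval x (multiAffine (translW a μ)) = MvPolynomial.eval (fun i => x i + a i) (multiAffine μ) := by
  rw [eval_multiAffine, eval_multiAffine]
  simp_rw [translW_apply, Finset.sum_mul]
  rw [Finset.sum_comm]
  refine Finset.sum_congr rfl fun T _ => ?_
  simp_rw [ite_mul, zero_mul]
  rw [Finset.prod_add, Finset.mul_sum]
  have hset : ∀ S : Finset σ, S ⊆ T ↔ S ∈ T.powerset := fun S => Finset.mem_powerset.symm
  simp_rw [hset]
  rw [Finset.sum_ite_mem, Finset.univ_inter]
  exact Finset.sum_congr rfl fun S _ => by ring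

/-- The translated weight generates the tree's `translate a (multiAffine μ)` (Brändén–Huh's `f(a + w)`).
[cite: BorceaBrandenLiggett2007, §2.1 Prop. 2.1 (2); BrandenHuh2019, §2.4 Lemma 2.20 (5)] -/
theorem multiAffine_translW (a : σ → ℝ) (μ : Finset σ → ℝ) :
    multiAffine (translW a μ) = translate a (multiAffine μ) :=
  MvPolynomial.funext fun x => by rw [eval_multiAffine_translW, eval_translate]

omit [Fintype σ] [DecidableEq σ] in
/-- `Δ_{ij}` commutes with translation. [cite: BorceaBrandenLiggett2007, §2.1 Prop. 2.1 (2); BrandenHuh2019, §2.4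
Lemma 2.20 (5)] -/
theorem rayleighDiff_translate (a : σ → ℝ) (i j : σ) (f : MvPolynomial σ ℝ) :
    rayleighDiff i j (translate a f) = translate a (rayleighDiff i j f) := by
  simp only [rayleighDiff, pderiv_translate]
  simp only [translate_def, map_mul, map_sub]

/-- **Borcea–Brändén–Liggett, Prop. 2.1 (2): the translation `f(z + α)`, `α ∈ ℝ_+^n`, of a Rayleigh polynomial
is Rayleigh** (`Δ_{ij}(f(z+α))(x) = Δ_{ij}(f)(x+α) ≥ 0`). [cite: BorceaBrandenLiggett2007, §2.1 Prop. 2.1 (2)] -/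
theorem isRayleigh_translW {μ : Finset σ → ℝ} (h : IsRayleigh μ) {a : σ → ℝ} (ha : ∀ i, 0 ≤ a i) :
    IsRayleigh (translW a μ) := by
  intro x hx i j
  rw [multiAffine_translW, rayleighDiff_translate, eval_translate]
  exact h _ (fun k => add_pos_of_pos_of_nonneg (hx k) (ha k)) i j

end Translation

/-! ## §2 Dilution in blocks (Prop. 2.1 (6)) -/

section Dilution

variable {τ : Type*} [Fintype τ] [DecidableEq τ]

/-- The block `b⁻¹(i)` of new variables above `i`. [cite: BorceaBrandenLiggett2007, §2.1 Prop. 2.1 (6)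
("`z_{i1},…,z_{ik}`")] -/
def blockOf (b : τ → σ) (i : σ) : Finset τ := Finset.univ.filter fun v => b v = i

omit [Fintype σ] [DecidableEq τ] in
/-- Membership in a block. [cite: BorceaBrandenLiggett2007, §2.1 Prop. 2.1 (6)] -/
@[simp] theorem mem_blockOf {b : τ → σ} {i : σ} {v : τ} : v ∈ blockOf b i ↔ b v = i := by
  simp [blockOf]

/-- **Block averages** `x̄_i = κ_i^{-1} Σ_{v ∈ b⁻¹(i)} x_v` (`k^{-1} Σ_i z_{ji}` in the source).
[cite: BorceaBrandenLiggett2007, §2.1 Prop. 2.1 (6)] -/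
def blockAvg (b : τ → σ) (x : τ → ℝ) : σ → ℝ := fun i => ((blockOf b i).card : ℝ)⁻¹ * ∑ v ∈ blockOf b i, x v

omit [Fintype σ] [DecidableEq τ] in
/-- Unfolding `blockAvg`. [cite: BorceaBrandenLiggett2007, §2.1 Prop. 2.1 (6)] -/
theorem blockAvg_apply (b : τ → σ) (x : τ → ℝ) (i : σ) :
    blockAvg b x i = ((blockOf b i).card : ℝ)⁻¹ * ∑ v ∈ blockOf b i, x v := rfl

omit [Fintype σ] [DecidableEq τ] in
/-- Block averages of a nonnegative point are nonnegative. [cite: BorceaBrandenLiggett2007, §2.1 Prop. 2.1 (6)] -/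
theorem blockAvg_nonneg (b : τ → σ) {x : τ → ℝ} (hx : ∀ v, 0 ≤ x v) (i : σ) : 0 ≤ blockAvg b x i :=
  mul_nonneg (inv_nonneg.2 (Nat.cast_nonneg _)) (Finset.sum_nonneg fun v _ => hx v)

/-- **The diluted weight**: `U ↦ μ(b(U)) Π_{v∈U} κ_{b(v)}^{-1}` if `b` is injective on `U` (a partial section of
the blocks), else `0` — the coefficient weight of `g_μ(x̄)` (`eval_multiAffine_dilute`).
[cite: BorceaBrandenLiggett2007, §2.1 Prop. 2.1 (6) ("the polynomial in `nk` variables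
`f(k^{-1}Σ z_{1i},…,k^{-1}Σ z_{ni})`")] -/
def dilute (b : τ → σ) (μ : Finset σ → ℝ) : Finset τ → ℝ := fun U =>
  if (U.image b).card = U.card then μ (U.image b) * ∏ v ∈ U, (((blockOf b (b v)).card : ℝ))⁻¹ else 0

omit [Fintype σ] [DecidableEq τ] in
/-- Unfolding `dilute`. [cite: BorceaBrandenLiggett2007, §2.1 Prop. 2.1 (6)] -/
theorem dilute_apply (b : τ → σ) (μ : Finset σ → ℝ) (U : Finset τ) :
    dilute b μ U =
      if (U.image b).card = U.card then μ (U.image b) * ∏ v ∈ U, (((blockOf b (b v)).card : ℝ))⁻¹ else 0 := rfl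

omit [Fintype σ] [DecidableEq τ] in
/-- Dilution keeps nonnegativity. [cite: BorceaBrandenLiggett2007, §2.1 Prop. 2.1 (6)] -/
theorem dilute_nonneg (b : τ → σ) {μ : Finset σ → ℝ} (h0 : ∀ S, 0 ≤ μ S) (U : Finset τ) : 0 ≤ dilute b μ U := by
  rw [dilute_apply]
  split_ifs
  · exact mul_nonneg (h0 _) (Finset.prod_nonneg fun v _ => inv_nonneg.2 (Nat.cast_nonneg _))
  · exact le_rfl

omit [Fintype σ] in
/-- **Expansion over sections**: `Π_{i∈S} Σ_{v ∈ b⁻¹(i)} c_v = Σ_U Π_{v∈U} c_v`, the sum over the partial sections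
`U` of `b` with `b(U) = S`. [cite: BorceaBrandenLiggett2007, §2.1 Prop. 2.1 (6) (expanding
`f(k^{-1}Σ z_{1i},…)`)] -/
theorem sum_sections_prod (b : τ → σ) (c : τ → ℝ) (S : Finset σ) :
    (∑ U ∈ Finset.univ.filter (fun U : Finset τ => (U.image b).card = U.card ∧ U.image b = S), ∏ v ∈ U, c v) =
      ∏ i ∈ S, ∑ v ∈ blockOf b i, c v := by
  induction S using Finset.induction_on with
  | empty =>
    have hfilt : Finset.univ.filter (fun U : Finset τ => (U.image b).card = U.card ∧ U.image b = ∅) = {∅} := by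
      ext U
      simp only [Finset.mem_filter, Finset.mem_univ, true_and, Finset.mem_singleton, Finset.image_eq_empty]
      constructor
      · exact fun h => h.2
      · rintro rfl; simp
    rw [hfilt, Finset.sum_singleton, Finset.prod_empty, Finset.prod_empty]
  | @insert i S hi ih =>
    rw [Finset.prod_insert hi, ← ih, Finset.sum_mul_sum, ← Finset.sum_product']
    symm
    refine Finset.sum_bij (fun p _ => insert p.1 p.2) ?_ ?_ ?_ ?_
    · -- lands in the sections above `insert i S`
      rintro ⟨v, U⟩ hp
      simp only [Finset.mem_product, mem_blockOf, Finset.mem_filter, Finset.mem_univ, true_and] at hp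
      obtain ⟨hv, hcard, himg⟩ := hp
      have hvU : v ∉ U := fun h' => hi (by rw [← himg, ← hv]; exact Finset.mem_image_of_mem b h')
      simp only [Finset.mem_filter, Finset.mem_univ, true_and]
      refine ⟨?_, by rw [Finset.image_insert, hv, himg]⟩
      rw [Finset.image_insert, hv, himg, Finset.card_insert_of_notMem hi, Finset.card_insert_of_notMem hvU,
        ← himg, hcard]
    · -- injective
      rintro ⟨v, U⟩ hp ⟨v', U'⟩ hp' heq
      simp only [Finset.mem_product, mem_blockOf, Finset.mem_filter, Finset.mem_univ, true_and] at hp hp'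
      simp only at heq
      have hvU : v ∉ U := fun h' => hi (by rw [← hp.2.2, ← hp.1]; exact Finset.mem_image_of_mem b h')
      have hvU' : v' ∉ U' := fun h' => hi (by rw [← hp'.2.2, ← hp'.1]; exact Finset.mem_image_of_mem b h')
      have hvv : v = v' := by
        have : v ∈ insert v' U' := by rw [← heq]; exact Finset.mem_insert_self v U
        rcases Finset.mem_insert.1 this with h' | h'
        · exact h'
        · exact absurd (by rw [← hp'.2.2, ← hp.1]; exact Finset.mem_image_of_mem b h') hi
      subst hvv
      have hUU : U = U' := by
        rw [← Finset.erase_insert hvU, heq, Finset.erase_insert hvU']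
      rw [hUU]
    · -- surjective
      intro U' hU'
      simp only [Finset.mem_filter, Finset.mem_univ, true_and] at hU'
      obtain ⟨hcard, himg⟩ := hU'
      have hinj : Set.InjOn b ↑U' := Finset.card_image_iff.1 hcard
      obtain ⟨v, hvU', hbv⟩ : ∃ v ∈ U', b v = i := by
        have : i ∈ U'.image b := by rw [himg]; exact Finset.mem_insert_self i S
        simpa only [Finset.mem_image] using this
      refine ⟨(v, U'.erase v), ?_, Finset.insert_erase hvU'⟩
      simp only [Finset.mem_product, mem_blockOf, Finset.mem_filter, Finset.mem_univ, true_and]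
      have himg' : (U'.erase v).image b = S := by
        ext j
        simp only [Finset.mem_image, Finset.mem_erase]
        constructor
        · rintro ⟨w, ⟨hwv, hwU'⟩, rfl⟩
          have hj : b w ∈ insert i S := by rw [← himg]; exact Finset.mem_image_of_mem b hwU'
          rcases Finset.mem_insert.1 hj with h' | h'
          · exact absurd (hinj hwU' hvU' (h'.trans hbv.symm)) hwv
          · exact h'
        · intro hj
          have hj' : j ∈ U'.image b := by rw [himg]; exact Finset.mem_insert_of_mem hj
          obtain ⟨w, hwU', rfl⟩ := Finset.mem_image.1 hj'
          refine ⟨w, ⟨fun h' => hi ?_, hwU'⟩, rfl⟩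
          rw [h', hbv] at hj
          exact hj
      refine ⟨hbv, ?_, himg'⟩
      rw [Finset.card_image_of_injOn (hinj.mono (Finset.coe_subset.2 (Finset.erase_subset v U')))]
    · -- the summands agree
      rintro ⟨v, U⟩ hp
      simp only [Finset.mem_product, mem_blockOf, Finset.mem_filter, Finset.mem_univ, true_and] at hp
      have hvU : v ∉ U := fun h' => hi (by rw [← hp.2.2, ← hp.1]; exact Finset.mem_image_of_mem b h')
      simp only
      rw [Finset.prod_insert hvU]

/-- **The generating polynomial of the diluted weight is `g_μ` at the block averages**:
`Σ_U (dilute b μ)(U) x^U = g_μ((κ_i^{-1} Σ_{v∈b⁻¹(i)} x_v)_i)`. [cite: BorceaBrandenLiggett2007, §2.1 Prop. 2.1 (6)] -/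
theorem eval_multiAffine_dilute (b : τ → σ) (μ : Finset σ → ℝ) (x : τ → ℝ) :
    MvPolynomial.eval x (multiAffine (dilute b μ)) = MvPolynomial.eval (blockAvg b x) (multiAffine μ) := by
  rw [eval_multiAffine, eval_multiAffine]
  -- regroup the sections `U` by their image `S = b(U)`
  have step1 : ∀ U : Finset τ, dilute b μ U * ∏ v ∈ U, x v =
      ∑ S : Finset σ, if (U.image b).card = U.card ∧ U.image b = S then
        μ S * ∏ v ∈ U, ((((blockOf b (b v)).card : ℝ))⁻¹ * x v) else 0 := by
    intro U
    rw [dilute_apply]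
    by_cases hU : (U.image b).card = U.card
    · simp only [hU, true_and, if_true]
      rw [Finset.sum_ite_eq Finset.univ (U.image b), if_pos (Finset.mem_univ _), Finset.prod_mul_distrib, mul_assoc]
    · simp only [hU, false_and, if_false, zero_mul, Finset.sum_const_zero]
  simp_rw [step1]
  rw [Finset.sum_comm]
  refine Finset.sum_congr rfl fun S _ => ?_
  rw [← Finset.sum_filter, ← Finset.mul_sum, sum_sections_prod]
  congr 1
  refine Finset.prod_congr rfl fun i _ => ?_
  rw [blockAvg_apply, Finset.mul_sum]
  exact Finset.sum_congr rfl fun v hv => by rw [mem_blockOf.1 hv]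

omit [DecidableEq σ] in
/-- `g_{c·μ} = c · g_μ`. [cite: BorceaBrandenLiggett2007, §2.1 (generating polynomials)] -/
theorem eval_multiAffine_smul (c : ℝ) (μ : Finset σ → ℝ) (x : σ → ℝ) :
    MvPolynomial.eval x (multiAffine (c • μ)) = c * MvPolynomial.eval x (multiAffine μ) := by
  rw [eval_multiAffine, eval_multiAffine, Finset.mul_sum]
  exact Finset.sum_congr rfl fun S _ => by rw [Pi.smul_apply, smul_eq_mul, mul_assoc]

omit [Fintype σ] [Fintype τ] in
/-- A partial section extends by `v` iff it stays injective: `b` is injective on `U ∪ {v}` (`v ∉ U`) iff it is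
injective on `U` and `b(v) ∉ b(U)`. [cite: BorceaBrandenLiggett2007, §2.1 Prop. 2.1 (6)] -/
theorem card_image_insert_eq_iff (b : τ → σ) {U : Finset τ} {v : τ} (hv : v ∉ U) :
    ((insert v U).image b).card = (insert v U).card ↔ (U.image b).card = U.card ∧ b v ∉ U.image b := by
  rw [Finset.card_image_iff, Finset.card_image_iff, Finset.coe_insert, Set.injOn_insert (by exact_mod_cast hv),
    ← Finset.coe_image, Finset.mem_coe]

omit [Fintype σ] in
/-- **`∂_v` of the dilution is `κ_{b(v)}^{-1}` times the dilution of `∂_{b(v)}`.**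
[cite: BorceaBrandenLiggett2007, §2.1 Prop. 2.1 (6)] -/
theorem derivWeight_dilute (b : τ → σ) (μ : Finset σ → ℝ) (v : τ) :
    derivWeight v (dilute b μ) = (((blockOf b (b v)).card : ℝ))⁻¹ • dilute b (derivWeight (b v) μ) := by
  funext U
  rw [Pi.smul_apply, smul_eq_mul, derivWeight_apply, dilute_apply, dilute_apply]
  by_cases hvU : v ∈ U
  · rw [if_pos hvU]
    split_ifs with hsec
    · rw [derivWeight_apply, if_pos (Finset.mem_image_of_mem b hvU), zero_mul, mul_zero]
    · rw [mul_zero]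
  · rw [if_neg hvU]
    by_cases hsec : ((insert v U).image b).card = (insert v U).card
    · obtain ⟨hsecU, hbv⟩ := (card_image_insert_eq_iff b hvU).1 hsec
      rw [if_pos hsec, if_pos hsecU, derivWeight_apply, if_neg hbv, Finset.image_insert, Finset.prod_insert hvU]
      ring
    · rw [if_neg hsec]
      split_ifs with hsecU
      · rw [derivWeight_apply]
        by_cases hbv : b v ∈ U.image b
        · rw [if_pos hbv, zero_mul, mul_zero]
        · exact absurd ((card_image_insert_eq_iff b hvU).2 ⟨hsecU, hbv⟩) hsec
      · rw [mul_zero]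

/-- **Borcea–Brändén–Liggett, Prop. 2.1 (6): the dilution `f(k^{-1}Σ_i z_{1i},…,k^{-1}Σ_i z_{ni})` of a Rayleigh
polynomial is Rayleigh** — here for an arbitrary block structure `b : τ → σ`:
`Δ_{vw}(dilution)(x) = κ_{b(v)}^{-1} κ_{b(w)}^{-1} Δ_{b(v) b(w)}(f)(x̄) ≥ 0`.
[cite: BorceaBrandenLiggett2007, §2.1 Prop. 2.1 (6)] -/
theorem isRayleigh_dilute (b : τ → σ) {μ : Finset σ → ℝ} (h : IsRayleigh μ) : IsRayleigh (dilute b μ) := by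
  intro x hx v w
  rw [eval_rayleighDiff_multiAffine, derivWeight_dilute, derivWeight_dilute, derivWeight_smul, derivWeight_dilute,
    eval_multiAffine_smul, eval_multiAffine_smul, eval_multiAffine_smul, eval_multiAffine_smul,
    eval_multiAffine_dilute, eval_multiAffine_dilute, eval_multiAffine_dilute, eval_multiAffine_dilute]
  have key := h.eval_rayleighDiff_nonneg (x := blockAvg b x) (fun i => blockAvg_nonneg b (fun u => (hx u).le) i)
    (b v) (b w)
  rw [eval_rayleighDiff_multiAffine] at key
  have hv : 0 ≤ (((blockOf b (b v)).card : ℝ))⁻¹ := inv_nonneg.2 (Nat.cast_nonneg _)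
  have hw : 0 ≤ (((blockOf b (b w)).card : ℝ))⁻¹ := inv_nonneg.2 (Nat.cast_nonneg _)
  have := mul_nonneg (mul_nonneg hv hw) key
  exact this.trans_eq (by ring)

/-- Prop. 2.1 (6) as printed: all blocks of the same size `k`, i.e. `τ = σ × [k]` and `b = pr_1`.
[cite: BorceaBrandenLiggett2007, §2.1 Prop. 2.1 (6)] -/
theorem isRayleigh_dilute_fst {k : ℕ} {μ : Finset σ → ℝ} (h : IsRayleigh μ) :
    IsRayleigh (dilute (Prod.fst : σ × Fin k → σ) μ) :=
  isRayleigh_dilute _ h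

omit [DecidableEq τ] in
/-- In the printed case every block has `k` elements. [cite: BorceaBrandenLiggett2007, §2.1 Prop. 2.1 (6)] -/
theorem card_blockOf_fst (k : ℕ) (i : σ) : (blockOf (Prod.fst : σ × Fin k → σ) i).card = k := by
  rw [blockOf]
  have : Finset.univ.filter (fun v : σ × Fin k => v.1 = i) = ({i} : Finset σ) ×ˢ (Finset.univ : Finset (Fin k)) := by
    ext ⟨j, l⟩
    simp [eq_comm]
  rw [this, Finset.card_product, Finset.card_singleton, one_mul, Finset.card_univ, Fintype.card_fin]

end Dilution

end Literature.Probability.NegativeDependence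

end
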